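import Mathlib
import Literature.Probability.Percolation.SmoothedWhiteNoise
import Literature.Probability.Percolation.PositiveAssociation
import Summits.CriticalPhenomena.CardyFormulaZ2.Theorems.CardyWhiteToColouredNoiseDiscretisationSignMeasurable
import Summits.CriticalPhenomena.CardyFormulaZ2.Theorems.CardyWhiteToColouredNoiseDiscretisationTail
import Summits.CriticalPhenomena.CardyFormulaZ2.Theorems.CardyWhiteToColouredDriftBoundStubWhiteEnd

/-!
# Stub stub_signLawPosAssoc — positive association of the sign law (line `birth` of crux `DriftBound`)

Helper file for crux item `DriftBound` (stmt-CriticalPhenomena-4596) of route `CardyWhiteToColoured`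
(`CardyFormulaZ2`), stub S3 of the registered line `Cruxes/DriftBound/Lines/birth.lean`
(skeleton v3: uniform Russo–Seymour–Welsh bounds for the family of lattice sign models
`signConfigLaw σ 1`, `σ > 0`, through the weak periodic Köhler-Schindler–Tassion theorem; this file
supplies the positive-association field of `KSTPeriodic.Admissible 1 0` for these laws).

For every width `σ > 0`, the law `signConfigLaw σ 1` (on bond configurations of `ℤ²`) of the sign
configuration `{e ∈ E(ℤ²) | (q_σ ⋆ ξ)(m_1 e) > 0}` of the lattice white noise `ξ` (i.i.d. `N(0,1)`
on the edges of `ℤ²`, sitting at the medial points `m_1(e)`) smoothed by the Gaussian kernel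
`q_σ(z) = exp(−|z|²/(2σ²))` is positively associated (FKG for increasing events):

* Harris' inequality: the product measure `latticeWhiteNoise = ⨂_e N(0,1)` on the coordinatewise
  ordered space `E(ℤ²) → ℝ` is positively associated (`isPositivelyAssociated_infinitePi`), and
  monotone measurable images of positively associated measures are positively associated
  (`IsPositivelyAssociated.map`);
* `signConfig σ 1` is not literally monotone in `ξ` (the unconditional sum defining the field takes
  the junk value `0` at the non-summable noises), but it agrees almost surely with the monotone
  measurable map `MonoSign[σ, ·]`: `e` is open iff for some `n : ℕ` the partial sums
  `∑_{e' ∈ s} q_σ(m_1 e − m_1 e') ξ_{e'}` are eventually, along the finite sets `s ↑ E(ℤ²)`, at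
  least `1/(n+1)` — each partial sum is increasing in `ξ` (positive weights), and on the
  full-measure set of noises against which the kernel sum converges absolutely at every medial
  point (`pa_ae_summable_gaussWeight_mul_abs`, Gaussian first moment times the convergent lattice
  sum of the kernel, `summable`/`tsum_ofReal_gaussWeight_medial_ne_top`) the partial sums converge
  to the field, so the condition reads "field `> 0`"; hence the two push-forwards of the white
  noise coincide (`Measure.map_congr`).

References: T. E. Harris, Proc. Cambridge Philos. Soc. 56 (1960), Lemma 4.1; G. Grimmett,
*Percolation* (1999), Thm. (2.4); L. D. Pitt, Ann. Probab. 10 (1982); S. Muirhead,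
H. Vanneuville, Ann. Inst. H. Poincaré Probab. Stat. 56 (2020), §2.1.
-/

noncomputable section

namespace Summit.CriticalPhenomena.CardyFormulaZ2.Cruxes.DriftBound.Birth

open Set Filter Topology MeasureTheory ProbabilityTheory
open scoped ENNReal NNReal
open Literature.Probability.LatticeModels Literature.Probability.Percolation
open Summit.CriticalPhenomena.CardyFormulaZ2.Theorems.WhiteToColoured

/-- `MonoSign[σ, ξ]`: the monotone modification of the sign configuration `signConfig σ 1 ξ` — the
edge `e ∈ E(ℤ²)` is open iff for some `n : ℕ` the partial sums `∑_{e' ∈ s} q_σ(m_1 e − m_1 e') ξ_{e'}`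
are eventually, along the finite sets `s ↑ E(ℤ²)`, at least `1/(n+1)`. -/
local notation3 "MonoSign[" σ ", " ξ "]" =>
  {e : Sym2 (Site 2) | e ∈ (zdGraph 2).edgeSet ∧ ∃ n : ℕ,
    ∀ᶠ s in (Filter.atTop : Filter (Finset (zdGraph 2).edgeSet)),
      (1 : ℝ) / (n + 1) ≤ ∑ e' ∈ s, gaussWeight σ (medialPoint 1 e - medialPoint 1 e'.1) *
        (ξ : (zdGraph 2).edgeSet → ℝ) e'}

/-! ### The lattice sum of the kernel of width `σ` at mesh `1` -/

/-- The Gaussian kernel is increasing in its width: `q_a(z) ≤ q_b(z)` for `0 < a ≤ b`. -/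
theorem pa_gaussWeight_mono {a b : ℝ} (ha : 0 < a) (hab : a ≤ b) (z : ℂ) :
    gaussWeight a z ≤ gaussWeight b z := by
  unfold gaussWeight
  refine Real.exp_le_exp.2 ?_
  rw [neg_div, neg_div, neg_le_neg_iff]
  exact div_le_div_of_nonneg_left (sq_nonneg _) (by positivity) (by nlinarith)

/-- **The lattice sum of the Gaussian kernel of any width `σ > 0` at mesh `1` converges** (as an
extended real): compare with the width `max σ 1 ≥ 1 = mesh` (`tsum_ofReal_gaussWeight_medial_ne_top`). -/
theorem pa_tsum_ofReal_gaussWeight_ne_top {σ : ℝ} (hσ : 0 < σ) (x : ℂ) :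
    ∑' e : (zdGraph 2).edgeSet, ENNReal.ofReal (gaussWeight σ (x - medialPoint 1 e.1)) ≠ ⊤ := by
  have h := tsum_ofReal_gaussWeight_medial_ne_top (lt_of_lt_of_le one_pos (le_max_right σ 1))
    one_pos (le_max_right σ 1) x
  refine ne_top_of_le_ne_top h (ENNReal.tsum_le_tsum fun e => ENNReal.ofReal_le_ofReal ?_)
  exact pa_gaussWeight_mono hσ (le_max_left σ 1) _

/-- **Almost surely, the kernel sum of width `σ` at mesh `1` converges absolutely against the
noise**: `∑' e', q_σ(x − m_1 e') |ξ_{e'}| < ∞` for `latticeWhiteNoise`-a.e. `ξ` (its expectation is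
`E|N(0,1)| · ∑' e', q_σ(x − m_1 e') < ∞`). Adapted from `ae_summable_gaussWeight_mul_abs`
(width = mesh) of the white-end stub. -/
theorem pa_ae_summable_gaussWeight_mul_abs {σ : ℝ} (hσ : 0 < σ) (x : ℂ) :
    ∀ᵐ ξ ∂latticeWhiteNoise, Summable fun e' : (zdGraph 2).edgeSet =>
      gaussWeight σ (x - medialPoint 1 e'.1) * |ξ e'| := by
  set Y : ((zdGraph 2).edgeSet → ℝ) → ℝ≥0∞ := fun ξ =>
    ∑' e' : (zdGraph 2).edgeSet, ‖gaussWeight σ (x - medialPoint 1 e'.1) * ξ e'‖ₑ with hY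
  have hmeas : ∀ e' : (zdGraph 2).edgeSet, Measurable fun ξ : (zdGraph 2).edgeSet → ℝ =>
      ‖gaussWeight σ (x - medialPoint 1 e'.1) * ξ e'‖ₑ := fun e' =>
    (measurable_const.mul (measurable_pi_apply e')).enorm
  have hYm : Measurable Y := Measurable.tsum hmeas
  have hYint : ∫⁻ ξ, Y ξ ∂latticeWhiteNoise ≠ ⊤ := by
    rw [hY, lintegral_tsum fun e' => (hmeas e').aemeasurable]
    have hle : ∀ e' : (zdGraph 2).edgeSet,
        ∫⁻ ξ, ‖gaussWeight σ (x - medialPoint 1 e'.1) * ξ e'‖ₑ ∂latticeWhiteNoise =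
          ENNReal.ofReal (gaussWeight σ (x - medialPoint 1 e'.1)) *
            ∫⁻ ξ, ‖ξ e'‖ₑ ∂latticeWhiteNoise := by
      intro e'
      have : (fun ξ : (zdGraph 2).edgeSet → ℝ => ‖gaussWeight σ (x - medialPoint 1 e'.1) * ξ e'‖ₑ) =
          fun ξ => ENNReal.ofReal (gaussWeight σ (x - medialPoint 1 e'.1)) * ‖ξ e'‖ₑ := by
        funext ξ
        rw [enorm_mul, Real.enorm_eq_ofReal (gaussWeight_pos σ _).le]
      rw [this, lintegral_const_mul _ (measurable_pi_apply e').enorm]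
    have hC : ∀ e' : (zdGraph 2).edgeSet,
        ∫⁻ ξ, ‖ξ e'‖ₑ ∂latticeWhiteNoise = ∫⁻ t : ℝ, ‖t‖ₑ ∂(gaussianReal 0 1) := fun e' =>
      (measurePreserving_eval_infinitePi (fun _ : (zdGraph 2).edgeSet => gaussianReal 0 1)
        e').lintegral_comp measurable_enorm
    have hCfin : ∫⁻ t : ℝ, ‖t‖ₑ ∂(gaussianReal 0 1) ≠ ⊤ := by
      have hint : Integrable (id : ℝ → ℝ) (gaussianReal 0 1) :=
        memLp_one_iff_integrable.1 (memLp_id_gaussianReal' 1 ENNReal.one_ne_top)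
      have hfin := hint.hasFiniteIntegral
      rw [HasFiniteIntegral] at hfin
      exact hfin.ne
    simp_rw [hle, hC]
    rw [ENNReal.tsum_mul_right]
    exact ENNReal.mul_ne_top (pa_tsum_ofReal_gaussWeight_ne_top hσ x) hCfin
  filter_upwards [ae_lt_top hYm hYint] with ξ hξ
  have h1 : (∑' e' : (zdGraph 2).edgeSet,
      ((‖gaussWeight σ (x - medialPoint 1 e'.1) * ξ e'‖₊ : ℝ≥0) : ℝ≥0∞)) ≠ ⊤ := hξ.ne
  have h2 := NNReal.summable_coe.2 (ENNReal.tsum_coe_ne_top_iff_summable.1 h1)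
  refine h2.congr fun e' => ?_
  simp only [coe_nnnorm, norm_mul, Real.norm_eq_abs, abs_of_pos (gaussWeight_pos σ _)]

/-! ### The monotone modification of the sign configuration -/

/-- Each partial sum `∑_{e' ∈ s} q_σ(m_1 e − m_1 e') ξ_{e'}` is increasing in the noise `ξ`
(the weights are positive). -/
theorem pa_sum_mono (σ : ℝ) (e : Sym2 (Site 2)) (s : Finset (zdGraph 2).edgeSet)
    {ξ ξ' : (zdGraph 2).edgeSet → ℝ} (h : ξ ≤ ξ') :
    ∑ e' ∈ s, gaussWeight σ (medialPoint 1 e - medialPoint 1 e'.1) * ξ e' ≤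
      ∑ e' ∈ s, gaussWeight σ (medialPoint 1 e - medialPoint 1 e'.1) * ξ' e' :=
  Finset.sum_le_sum fun e' _ => mul_le_mul_of_nonneg_left (h e') (gaussWeight_pos σ _).le

/-- **The modification is increasing in the noise**: raising `ξ` raises every partial sum, so
eventual lower bounds persist, `MonoSign[σ, ξ] ⊆ MonoSign[σ, ξ']` for `ξ ≤ ξ'`. -/
theorem pa_monoSign_mono (σ : ℝ) :
    Monotone fun ξ : (zdGraph 2).edgeSet → ℝ => MonoSign[σ, ξ] := by
  intro ξ ξ' h e he
  rw [mem_setOf_eq] at he ⊢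
  obtain ⟨heE, n, hn⟩ := he
  exact ⟨heE, n, hn.mono fun s hs => hs.trans (pa_sum_mono σ e s h)⟩

/-- **The modification is measurable**: `Finset E(ℤ²)` is countable, so "eventually along the
finite sets" (`Filter.eventually_atTop`) is a countable union of countable intersections of the
measurable events `{ξ | 1/(n+1) ≤ ∑_{e' ∈ s} q_σ(m_1 e − m_1 e') ξ_{e'}}`. -/
theorem pa_measurable_monoSign (σ : ℝ) :
    Measurable fun ξ : (zdGraph 2).edgeSet → ℝ => MonoSign[σ, ξ] := by
  refine measurable_set_iff.2 fun e => ?_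
  simp only [mem_setOf_eq, eventually_atTop]
  refine measurable_const.and (Measurable.exists fun n => Measurable.exists fun a =>
    Measurable.forall fun b => measurable_const.imp ?_)
  exact measurableSet_setOf.1 (measurableSet_le measurable_const
    (Finset.measurable_sum b fun e' _ => measurable_const.mul (measurable_pi_apply e')))

/-- **On the noises against which the kernel sum at `m_1 e` converges absolutely, the modification
is the sign configuration at `e`**: the partial sums tend to the field
`F = ∑' e', q_σ(m_1 e − m_1 e') ξ_{e'}` (`Summable.hasSum`), so they are eventually `≥ 1/(n+1)` for
some `n` iff `F > 0` (`ge_of_tendsto` one way, `exists_nat_one_div_lt` and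
`Tendsto.eventually_const_le` the other). -/
theorem pa_mem_monoSign_iff {σ : ℝ} {ξ : (zdGraph 2).edgeSet → ℝ} {e : Sym2 (Site 2)}
    (hξ : Summable fun e' : (zdGraph 2).edgeSet =>
      gaussWeight σ (medialPoint 1 e - medialPoint 1 e'.1) * |ξ e'|) :
    e ∈ MonoSign[σ, ξ] ↔ e ∈ signConfig σ 1 ξ := by
  rw [mem_signConfig_iff, mem_setOf_eq, smoothedNoise_eq_tsum_gaussWeight]
  refine and_congr_right fun _ => ?_
  have hgs : Summable fun e' : (zdGraph 2).edgeSet =>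
      gaussWeight σ (medialPoint 1 e - medialPoint 1 e'.1) * ξ e' := by
    refine Summable.of_norm (hξ.congr fun e' => ?_)
    rw [norm_mul, Real.norm_eq_abs, Real.norm_eq_abs, abs_of_pos (gaussWeight_pos σ _)]
  have ht : Tendsto (fun s : Finset (zdGraph 2).edgeSet =>
      ∑ e' ∈ s, gaussWeight σ (medialPoint 1 e - medialPoint 1 e'.1) * ξ e') atTop
      (𝓝 (∑' e' : (zdGraph 2).edgeSet, gaussWeight σ (medialPoint 1 e - medialPoint 1 e'.1) * ξ e')) :=
    hgs.hasSum
  constructor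
  · rintro ⟨n, hn⟩
    have h1 : (1 : ℝ) / (n + 1) ≤
        ∑' e' : (zdGraph 2).edgeSet, gaussWeight σ (medialPoint 1 e - medialPoint 1 e'.1) * ξ e' :=
      ge_of_tendsto ht hn
    exact lt_of_lt_of_le Nat.one_div_pos_of_nat h1
  · intro hpos
    obtain ⟨n, hn⟩ := exists_nat_one_div_lt hpos
    exact ⟨n, ht.eventually_const_le hn⟩

/-- **The modification agrees with the sign configuration almost surely**: on the full-measure set
of noises against which the kernel sum converges absolutely at every medial point (countably many,
`ae_all_iff` and `pa_ae_summable_gaussWeight_mul_abs`), `MonoSign[σ, ξ] = signConfig σ 1 ξ`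
(edge by edge, `pa_mem_monoSign_iff`; non-edges are closed in both). -/
theorem pa_monoSign_ae_eq_signConfig {σ : ℝ} (hσ : 0 < σ) :
    (fun ξ : (zdGraph 2).edgeSet → ℝ => MonoSign[σ, ξ]) =ᵐ[latticeWhiteNoise] signConfig σ 1 := by
  have h : ∀ᵐ ξ ∂latticeWhiteNoise, ∀ e : (zdGraph 2).edgeSet,
      Summable fun e' : (zdGraph 2).edgeSet =>
        gaussWeight σ (medialPoint 1 e.1 - medialPoint 1 e'.1) * |ξ e'| :=
    ae_all_iff.2 fun e => pa_ae_summable_gaussWeight_mul_abs hσ (medialPoint 1 e.1)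
  filter_upwards [h] with ξ hξ
  ext e
  by_cases he : e ∈ (zdGraph 2).edgeSet
  · exact pa_mem_monoSign_iff (hξ ⟨e, he⟩)
  · simp only [mem_setOf_eq, mem_signConfig_iff, he, false_and]

/-- **The sign law is the push-forward of the white noise under the monotone modification**
(`Measure.map_congr` along the almost sure equality `pa_monoSign_ae_eq_signConfig`). -/
theorem pa_signConfigLaw_eq_map_monoSign {σ : ℝ} (hσ : 0 < σ) :
    signConfigLaw σ 1 =
      latticeWhiteNoise.map fun ξ : (zdGraph 2).edgeSet → ℝ => MonoSign[σ, ξ] := by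
  unfold signConfigLaw
  exact (Measure.map_congr (pa_monoSign_ae_eq_signConfig hσ)).symm

/-- **Harris' inequality for the lattice white noise**: the product Gaussian measure
`⨂_{e ∈ E(ℤ²)} N(0,1)` on the coordinatewise ordered space `E(ℤ²) → ℝ` is positively associated
(`isPositivelyAssociated_infinitePi`). -/
theorem pa_isPositivelyAssociated_latticeWhiteNoise : IsPositivelyAssociated latticeWhiteNoise := by
  unfold latticeWhiteNoise
  exact isPositivelyAssociated_infinitePi _

/-- **Stub S3 — positive association of the sign law.** For every `σ > 0` the law
`signConfigLaw σ 1` of the sign configuration of the Gaussian-smoothed lattice white noise is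
positively associated: it is the push-forward of the positively associated product measure
`latticeWhiteNoise` (Harris, `pa_isPositivelyAssociated_latticeWhiteNoise`) under the monotone
measurable modification `MonoSign[σ, ·]` of `signConfig σ 1` (`pa_signConfigLaw_eq_map_monoSign`,
`pa_monoSign_mono`, `pa_measurable_monoSign`), and monotone measurable images of positively
associated measures are positively associated (`IsPositivelyAssociated.map`). -/
theorem stub_signLawPosAssoc :
    ∀ σ : ℝ, 0 < σ →
      Literature.Probability.Percolation.IsPositivelyAssociated
        (Literature.Probability.Percolation.signConfigLaw σ 1) := by
  intro σ hσ
  rw [pa_signConfigLaw_eq_map_monoSign hσ]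
  exact pa_isPositivelyAssociated_latticeWhiteNoise.map (pa_monoSign_mono σ)
    (pa_measurable_monoSign σ)

end Summit.CriticalPhenomena.CardyFormulaZ2.Cruxes.DriftBound.Birth
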